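import Literature.MathematicalPhysics.QuantumFieldTheory.Balaban1983to89.Node00.LargeFieldReprOfRecord
import Literature.MathematicalPhysics.QuantumFieldTheory.Balaban1983to89.Node00.Record12MinimiserSelection
import Literature.MathematicalPhysics.QuantumFieldTheory.Balaban1983to89.Node00.Record12MeasurabilityAbsolute

/-!
# NODE 00 — DEFINER ₇, FILE 19 (R-side root of the «Record 13» re-point): the (2.12) BACKGROUND DATUM AS A PARAMETER —
# background-datum families `𝔟`, the family OF RECORD (bare choice, FILE 1) and the SELECTION family (K0c's `bgSelOfRecord`),
# the characteristic functions `χ_k(T_η)` ∕ `χ_k(Ω_k)` of record GENERIC in `𝔟`, and (H-U) generic in `𝔟` — a THEOREM at the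
# selection family (v1.1: and at the family of record)

v1.1 (def-R g8, 2026-08-27): + `localBgMeasurableBg_bgFam(_iff)` (new import `Record12MeasurabilityAbsolute`); the file is REBUILT
against FILE 1 v2 (`SmallFieldChiOfRecord`, `[MeasurableSpace G]` binder on `UminOfRecord`∕`bgOfRecord`) and `Record12MinimiserSelection` v1.2 —
its v1.0 artefact predated both in-place edits (referee H READ-81 build-hygiene note); no statement of v1.0 changes.

Seat `pub-ymgap-node00-def-R` (DEFINER ₇, g8).  [III] = [Balaban1988Convergent], [IV] = [Balaban1989LargeFieldI].

WHY THIS FILE (director-ym LINE №125 «GO RECORD 13 … adopting (H-U) `bgSelOfRecord`»; def-R census `REPOINT-BGSEL-CONE-CENSUS.md`).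
Every carrier of the R-side of record reads the (2.12) solution datum through ONE term,
`bgOfRecord (avOfRecord F N K) {U | PlaqSmall (ν.εreg * (F.P K).eta k ^ 2) U} : DetBackground (F.P K) (SU N) (avOfRecord F N K)` (FILE 1 §2: the
minimiser chosen by `Classical.choose`, about which no measurability can be proved), and K0′'s rows P1–P3 ∕ P6 at the witness of record therefore
carry the DISPLAYED hypothesis (H-U) `Record12Measurability.LocalBgMeasurable`.  K0c's `Record12MinimiserSelection.bgSelOfRecord` is the same datum
with a MEASURABLY SELECTED minimiser, for which (H-U) is the theorem `measurable_ukBox_bgSel`.  A successor record re-pointed to it needs every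
R-side carrier GENERIC in the datum.  This file is the root of that family and changes nothing in place:
* §1 `BgFam F N` — a background-datum family `𝔟 K k : DetBackground (F.P K) (SU N) (avOfRecord F N K)` (one r12 datum per torus `K` and level
  `k`, since the regularity class `|U(∂p) − 1| < εreg·η_k²` depends on both); the family OF RECORD `bgFamOfRecord ν` (`= bgOfRecord …`, `rfl`) and
  the SELECTION family `bgSelFamOfRecord ν` (`= bgSelOfRecord …`, `rfl`); same regularity class, same solvable domain (`rfl`), both minimise
  on the domain.
* §2 (H-U) generic: `LocalBgMeasurableBg ν 𝔟` (K0c's `LocalBgMeasurable` with `bgOfRecord … ↦ 𝔟 K k`; at `𝔟 := bgFamOfRecord ν` it is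
  that clause letter for letter), **`localBgMeasurableBg_bgSelFam` : it HOLDS at the selection family** (K0c p477848, by name) and —
  v1.1 — **`localBgMeasurableBg_bgFam` : it HOLDS AT THE FAMILY OF RECORD** (K0c's hypothesis-free `localBgMeasurable`, p488525, by name;
  `localBgMeasurableBg_bgFam_iff` : at `𝔟 := bgFamOfRecord ν` the clause IS K0c's `LocalBgMeasurable F N ν`, `Iff.rfl`).
* §3 `chiOfRecordBg 𝔟` ∕ `chiSeqOfRecordBg 𝔟` — FILE 1's `χ_k(T_η)` (2.17) and FILE 4's `χ_k(Ω_k)` (2.17)–(2.18) with the datum a parameter;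
  RECOVERY of the carriers of record at `𝔟 := bgFamOfRecord ν` by `rfl` (`chiOfRecordBg_bgFam`, `chiSeqOfRecordBg_bgFam`), and the generic
  faces FILE 1 ∕ FILE 4 prove for the record (`0 ≤ χ ≤ 1`, `χ = 1 ↔ all plaquettes small`, the `M₂ = 0` junk corner, `Ω_k = T_η ⇒ χ_k(Ω_k) = χ_k(T_η)`).
Sequel files twin the R-step slot machinery (FILE 5 ∕ 8), the measurable-modification background (FILE 16) and the integrable R-step provisos
(FILE 17 §6) in the same way; def-T's weights ∕ T-step ∕ tower ∕ `Record13` read these by name.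

HONEST SCOPE.  Definitions of record with one extra parameter + kernel bookkeeping (`rfl`, FILE 1's three-line proofs repeated verbatim);
§2's theorem is K0c's `measurable_ukBox_bgSel` BY NAME.  Nothing of Bałaban's is asserted; no record is restated or edited; (H-U) for the
family OF RECORD stays exactly as displayed; K0′ is NOT discharged; counts unmoved (typed 28∕28 · discharged 5∕28).  One finite 𝕋⁴ programme
at fixed `ε = L^{−K}` — NOT continuum ∕ OS ∕ mass gap ∕ Clay.  No `sorry`, no `axiom`, no `instance`, no `notation`.
-/

open MeasureTheory
open scoped BigOperators

namespace Literature.MathematicalPhysics.QuantumFieldTheory.Balaban1983to89.Node00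

open T4Continuum B15DeterminingSets B14.Eq213DetSet B14.Eq216Concrete B14.Eq213MaximalDomains B15Eq112TorusCover B14DomainGeom
  B14.Eq218Concrete

noncomputable section

variable (F : T4Family) (N : ℕ) [NeZero N]

/-! ## §1  Background-datum families: the family of record and the selection family -/

/-- A BACKGROUND-DATUM FAMILY of the record's shape: for every torus exponent `K` and level `k`, an r12 (2.12) solution datum
(`B15DeterminingSets.DetBackground`: regularity class, solvable domain, solution map, minimising property on the domain) over `SU(N)` and the
averaging of record. [cite: Balaban1988Convergent, (2.12) p.256] -/
abbrev BgFam : Type :=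
  (K k : ℕ) → DetBackground (F.P K) (SU N) (avOfRecord F N K)

/-- **The background-datum family OF RECORD**: FILE 1's bare-choice datum `bgOfRecord` over the regularity class `|U(∂p) − 1| < εreg·η_k²` —
the term every carrier of record reads. [cite: Balaban1988Convergent, (2.12) p.256] -/
def bgFamOfRecord (ν : Stage7Numerics) : BgFam F N :=
  fun K k => bgOfRecord (avOfRecord F N K) {U | PlaqSmall (ν.εreg * (F.P K).eta k ^ 2) U}

/-- Unfolding: the family of record IS the term of record. [cite: Balaban1988Convergent, (2.12) p.256 (bookkeeping)] -/
theorem bgFamOfRecord_apply (ν : Stage7Numerics) (K k : ℕ) :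
    bgFamOfRecord F N ν K k = bgOfRecord (avOfRecord F N K) {U | PlaqSmall (ν.εreg * (F.P K).eta k ^ 2) U} := rfl

/-- **The SELECTION family**: K0c's re-pointed datum `bgSelOfRecord` (minimiser measurably selected where a measurable selector exists) over
the same regularity class. [cite: Balaban1988Convergent, (2.12) p.256] -/
def bgSelFamOfRecord (ν : Stage7Numerics) : BgFam F N :=
  fun K k => bgSelOfRecord (avOfRecord F N K) {U : GaugeField (F.P K) 0 (SU N) | PlaqSmall (ν.εreg * (F.P K).eta k ^ 2) U}

/-- Unfolding of the selection family. [cite: Balaban1988Convergent, (2.12) p.256 (bookkeeping)] -/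
theorem bgSelFamOfRecord_apply (ν : Stage7Numerics) (K k : ℕ) :
    bgSelFamOfRecord F N ν K k =
      bgSelOfRecord (avOfRecord F N K) {U : GaugeField (F.P K) 0 (SU N) | PlaqSmall (ν.εreg * (F.P K).eta k ^ 2) U} := rfl

/-- The two families have the SAME regularity class … [cite: Balaban1988Convergent, (2.12) p.256 (bookkeeping)] -/
theorem bgSelFamOfRecord_reg (ν : Stage7Numerics) (K k : ℕ) :
    (bgSelFamOfRecord F N ν K k).reg = (bgFamOfRecord F N ν K k).reg := rfl

/-- … and the SAME solvable domain (the data `W` admitting a minimiser). [cite: Balaban1988Convergent, (2.12) p.256 (bookkeeping)] -/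
theorem bgSelFamOfRecord_dom (ν : Stage7Numerics) (K k : ℕ) :
    (bgSelFamOfRecord F N ν K k).dom = (bgFamOfRecord F N ν K k).dom := rfl

/-- The solution map of the family of record is FILE 1's bare choice `UminOfRecord`. [cite: Balaban1988Convergent, (2.12) p.256 (bookkeeping)] -/
theorem bgFamOfRecord_U (ν : Stage7Numerics) (K k : ℕ) :
    (bgFamOfRecord F N ν K k).U = UminOfRecord (avOfRecord F N K) {U | PlaqSmall (ν.εreg * (F.P K).eta k ^ 2) U} := rfl

/-- The solution map of the selection family is K0c's `UminSelOfRecord`. [cite: Balaban1988Convergent, (2.12) p.256 (bookkeeping)] -/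
theorem bgSelFamOfRecord_U (ν : Stage7Numerics) (K k : ℕ) :
    (bgSelFamOfRecord F N ν K k).U =
      UminSelOfRecord (avOfRecord F N K) {U : GaugeField (F.P K) 0 (SU N) | PlaqSmall (ν.εreg * (F.P K).eta k ^ 2) U} := rfl

/-- Both families MINIMISE on the common domain (the `isMinimizer` field of each datum): they differ only in WHICH minimiser is chosen.
[cite: Balaban1988Convergent, (2.12) p.256 (bookkeeping)] -/
theorem isMinimizer_bgFam_and_bgSelFam (ν : Stage7Numerics) (K k : ℕ) (𝔹 : DetSet (F.P K)) (W : MSField (F.P K) (SU N))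
    (hW : W ∈ (bgFamOfRecord F N ν K k).dom 𝔹) :
    IsMinimizer (avOfRecord F N K) {U | PlaqSmall (ν.εreg * (F.P K).eta k ^ 2) U} 𝔹 W ((bgFamOfRecord F N ν K k).U 𝔹 W) ∧
      IsMinimizer (avOfRecord F N K) {U | PlaqSmall (ν.εreg * (F.P K).eta k ^ 2) U} 𝔹 W ((bgSelFamOfRecord F N ν K k).U 𝔹 W) :=
  ⟨(bgFamOfRecord F N ν K k).isMinimizer 𝔹 W hW, (bgSelFamOfRecord F N ν K k).isMinimizer 𝔹 W hW⟩

/-! ## §2  (H-U) generic in the datum — a THEOREM at the selection family -/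

/-- **(H-U) FOR A BACKGROUND-DATUM FAMILY**: every (2.16) local background `V_k ↦ U_{k,□}(V_k) = U(𝐁_k(□), M˙(Q_k^{s*}V_k))` over `𝔟 K k`
(layer width `M₁`) is a measurable map of the field — K0c's `Record12Measurability.LocalBgMeasurable F N ν` with `bgOfRecord … ↦ 𝔟 K k`
(at `𝔟 := bgFamOfRecord F N ν` the two clauses agree letter for letter). [cite: Balaban1988Convergent, (2.16) p.257] -/
def LocalBgMeasurableBg (ν : Stage7Numerics) (𝔟 : BgFam F N) : Prop :=
  ∀ (K k : ℕ) (box4 : Set (Site (F.P K) 0)), Measurable (ukBox (𝔟 K k) ν.M₁ box4 k)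

/-- **(H-U) HOLDS AT THE SELECTION FAMILY** — K0c's `measurable_ukBox_bgSel` (p477848), by name. [cite: Balaban1988Convergent, (2.16) p.257] -/
theorem localBgMeasurableBg_bgSelFam (ν : Stage7Numerics) : LocalBgMeasurableBg F N ν (bgSelFamOfRecord F N ν) :=
  fun K k box4 => measurable_ukBox_bgSel F N ν K k box4

/-- v1.1: at the family OF RECORD the clause is K0c's `Record12Measurability.LocalBgMeasurable F N ν`, letter for letter.
[cite: Balaban1988Convergent, (2.16) p.257 (bookkeeping)] -/
theorem localBgMeasurableBg_bgFam_iff (ν : Stage7Numerics) :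
    LocalBgMeasurableBg F N ν (bgFamOfRecord F N ν) ↔ LocalBgMeasurable F N ν := Iff.rfl

/-- v1.1: **(H-U) HOLDS AT THE FAMILY OF RECORD** — K0c's hypothesis-free `Record12MeasurabilityAbsolute.localBgMeasurable` (p488525:
the measurable minimiser selection of `Record12MinimiserSelection` v1.2 fed to FILE 1 v2's `measurable_UminOfRecord_of_selector`), by name.
So (H-U) is a theorem at BOTH families of §1; no consumer needs the selection family for measurability any more.
[cite: Balaban1988Convergent, (2.16) p.257] -/
theorem localBgMeasurableBg_bgFam (ν : Stage7Numerics) : LocalBgMeasurableBg F N ν (bgFamOfRecord F N ν) :=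
  (localBgMeasurableBg_bgFam_iff F N ν).2 (localBgMeasurable F N ν)

/-- Component form of (H-U) for a family. [cite: Balaban1988Convergent, (2.16) p.257 (bookkeeping)] -/
theorem LocalBgMeasurableBg.measurable_ukBox {ν : Stage7Numerics} {𝔟 : BgFam F N} (h : LocalBgMeasurableBg F N ν 𝔟) (K k : ℕ)
    (box4 : Set (Site (F.P K) 0)) : Measurable (ukBox (𝔟 K k) ν.M₁ box4 k) :=
  h K k box4

/-! ## §3  `χ_k(T_η)` and `χ_k(Ω_k)` of record, generic in the datum -/

/-- **`χ_k(T_η)` OVER A DATUM FAMILY** — FILE 1's `chiOfRecord` ((2.17) [III]: the product over ALL `LM₂R_k`-cubes of the characteristic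
functions of `{sup_{p⊂□^∼}|U_{k,□}(V_k, ∂p) − 1| < ε_kη²}`) with the (2.12) datum `𝔟 K k` in place of `bgOfRecord …`; every other input pinned as in
FILE 1. [cite: Balaban1988Convergent, (2.17) p.257] -/
def chiOfRecordBg (𝔟 : BgFam F N) (ν : Stage7Numerics) (g : ℕ → ℝ) (K k : ℕ) :
    GaugeField (F.P K) k (SU N) → ℝ :=
  chi217 (𝔟 K k) ν.M₁
    (cubeIndices (F.P K) (cubeSide (F.P K).L ν.M₂ (RkOfRecord (F.P K).L ν.r (g k)) k))
    (fun a => plaqInside (cubeEnl (F.P K) (cubeSide (F.P K).L ν.M₂ (RkOfRecord (F.P K).L ν.r (g k)) k) a 1))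
    (fun a => cubeEnl (F.P K) (cubeSide (F.P K).L ν.M₂ (RkOfRecord (F.P K).L ν.r (g k)) k) a 4)
    (epsOfRecord ν g k) k

/-- **RECOVERY**: at the family of record, `χ_k(T_η)` over the family IS FILE 1's `chiOfRecord`. [cite: Balaban1988Convergent, (2.17) p.257 (bookkeeping)] -/
theorem chiOfRecordBg_bgFam (ν : Stage7Numerics) (g : ℕ → ℝ) (K k : ℕ) :
    chiOfRecordBg F N (bgFamOfRecord F N ν) ν g K k = chiOfRecord F N ν g K k := rfl

/-- Unfolding of `χ_k(T_η)` over a family as r11's (2.17) `chi217`. [cite: Balaban1988Convergent, (2.17) p.257 (bookkeeping)] -/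
theorem chiOfRecordBg_eq_chi217 (𝔟 : BgFam F N) (ν : Stage7Numerics) (g : ℕ → ℝ) (K k : ℕ) :
    chiOfRecordBg F N 𝔟 ν g K k =
      chi217 (𝔟 K k) ν.M₁
        (cubeIndices (F.P K) (cubeSide (F.P K).L ν.M₂ (RkOfRecord (F.P K).L ν.r (g k)) k))
        (fun a => plaqInside (cubeEnl (F.P K) (cubeSide (F.P K).L ν.M₂ (RkOfRecord (F.P K).L ν.r (g k)) k) a 1))
        (fun a => cubeEnl (F.P K) (cubeSide (F.P K).L ν.M₂ (RkOfRecord (F.P K).L ν.r (g k)) k) a 4)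
        (epsOfRecord ν g k) k := rfl

/-- `0 ≤ χ_k(T_η)` over any family (a product of 0∕1 characteristic functions). [cite: Balaban1988Convergent, (2.17) p.257 (bookkeeping)] -/
theorem chiOfRecordBg_nonneg (𝔟 : BgFam F N) (ν : Stage7Numerics) (g : ℕ → ℝ) (K k : ℕ)
    (V : GaugeField (F.P K) k (SU N)) : 0 ≤ chiOfRecordBg F N 𝔟 ν g K k V := by
  rw [chiOfRecordBg_eq_chi217, chi217_apply]
  exact Finset.prod_nonneg fun _ _ => by unfold chiSmall; split_ifs <;> norm_num

/-- `χ_k(T_η) ≤ 1` over any family. [cite: Balaban1988Convergent, (2.17) p.257 (bookkeeping)] -/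
theorem chiOfRecordBg_le_one (𝔟 : BgFam F N) (ν : Stage7Numerics) (g : ℕ → ℝ) (K k : ℕ)
    (V : GaugeField (F.P K) k (SU N)) : chiOfRecordBg F N 𝔟 ν g K k V ≤ 1 := by
  rw [chiOfRecordBg_eq_chi217, chi217_apply]
  exact Finset.prod_le_one (fun _ _ => by unfold chiSmall; split_ifs <;> norm_num)
    fun _ _ => by unfold chiSmall; split_ifs <;> norm_num

/-- `χ_k(T_η)(V_k) = 1` over a family exactly when, for every cube `□`, all plaquettes `p ⊂ □^∼` are small for the local background
`U_{k,□}(V_k)` OF THAT FAMILY (r11's `chi217_eq_one_iff`). [cite: Balaban1988Convergent, (2.17) p.257] -/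
theorem chiOfRecordBg_eq_one_iff (𝔟 : BgFam F N) (ν : Stage7Numerics) (g : ℕ → ℝ) (K k : ℕ)
    (V : GaugeField (F.P K) k (SU N)) :
    chiOfRecordBg F N 𝔟 ν g K k V = 1 ↔
      ∀ a ∈ cubeIndices (F.P K) (cubeSide (F.P K).L ν.M₂ (RkOfRecord (F.P K).L ν.r (g k)) k),
        PlaqSmallOn (plaqInside (cubeEnl (F.P K) (cubeSide (F.P K).L ν.M₂ (RkOfRecord (F.P K).L ν.r (g k)) k) a 1))
          (epsOfRecord ν g k * (F.P K).eta k ^ 2)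
          (ukBox (𝔟 K k) ν.M₁ (cubeEnl (F.P K) (cubeSide (F.P K).L ν.M₂ (RkOfRecord (F.P K).L ν.r (g k)) k) a 4) k V) := by
  rw [chiOfRecordBg_eq_chi217]
  exact chi217_eq_one_iff _ _ _ _ _ _ _ _

/-- JUNK CORNER over any family: with `M₂ = 0` the cube family is empty and `χ_k(T_η) ≡ 1` (FILE 1's `chiOfRecord_of_M₂_eq_zero`, same proof).
[cite: Balaban1988Convergent, (2.17) p.257 (typing convention)] -/
theorem chiOfRecordBg_of_M₂_eq_zero (𝔟 : BgFam F N) (ν : Stage7Numerics) (hM : ν.M₂ = 0) (g : ℕ → ℝ) (K k : ℕ)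
    (V : GaugeField (F.P K) k (SU N)) : chiOfRecordBg F N 𝔟 ν g K k V = 1 := by
  rw [chiOfRecordBg_eq_chi217, chi217_apply]
  have hs : cubeSide (F.P K).L ν.M₂ (RkOfRecord (F.P K).L ν.r (g k)) k = 0 := by simp [cubeSide, hM]
  haveI : Nonempty (Fin (F.P K).d) := ⟨⟨0, (F.P K).hd⟩⟩
  rw [hs]
  simp [cubeIndices]

/-- **`χ_k(Ω_k)` OVER A DATUM FAMILY, for a sequence** — FILE 4's `chiSeqOfRecord` (r11's `chi218` with every input pinned) with the datum
`𝔟 K k` in place of `bgOfRecord …`. [cite: Balaban1988Convergent, (2.17)–(2.18) p.257] -/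
def chiSeqOfRecordBg (𝔟 : BgFam F N) (ν : Stage7Numerics) (M : ℕ) (g : ℕ → ℝ) (K k : ℕ) (s : SeqOfRecord F ν M g K k) :
    GaugeField (F.P K) k (SU N) → ℝ :=
  chi218 (ι := ↥(cubeIndices (F.P K) (cubeSide (F.P K).L ν.M₂ (RkOfRecord (F.P K).L ν.r (g k)) k)))
    (𝔟 K k) ν.M₁
    (fun a => cubeEnl (F.P K) (cubeSide (F.P K).L ν.M₂ (RkOfRecord (F.P K).L ν.r (g k)) k) a 0)
    (fun a => plaqInside (cubeEnl (F.P K) (cubeSide (F.P K).L ν.M₂ (RkOfRecord (F.P K).L ν.r (g k)) k) a 1))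
    (fun a => cubeEnl (F.P K) (cubeSide (F.P K).L ν.M₂ (RkOfRecord (F.P K).L ν.r (g k)) k) a 4)
    (epsOfRecord ν g k) k s

/-- **RECOVERY**: at the family of record, `χ_k(Ω_k)` over the family IS FILE 4's `chiSeqOfRecord`.
[cite: Balaban1988Convergent, (2.17)–(2.18) p.257 (bookkeeping)] -/
theorem chiSeqOfRecordBg_bgFam (ν : Stage7Numerics) (M : ℕ) (g : ℕ → ℝ) (K k : ℕ) (s : SeqOfRecord F ν M g K k) :
    chiSeqOfRecordBg F N (bgFamOfRecord F N ν) ν M g K k s = chiSeqOfRecord F N ν M g K k s := rfl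

/-- Pointwise unfolding of `χ_k(Ω_k)` over a family: the product over the cubes INSIDE `Ω_k` of the cube characteristic functions over the
family's local backgrounds (r11's `chi218_apply` ∕ `chi217`). [cite: Balaban1988Convergent, (2.17) p.257 (bookkeeping)] -/
theorem chiSeqOfRecordBg_apply (𝔟 : BgFam F N) (ν : Stage7Numerics) (M : ℕ) (g : ℕ → ℝ) (K k : ℕ) (s : SeqOfRecord F ν M g K k)
    (V : GaugeField (F.P K) k (SU N)) :
    chiSeqOfRecordBg F N 𝔟 ν M g K k s V =
      ∏ a ∈ cubesIn (fun a : ↥(cubeIndices (F.P K) (cubeSide (F.P K).L ν.M₂ (RkOfRecord (F.P K).L ν.r (g k)) k)) =>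
          cubeEnl (F.P K) (cubeSide (F.P K).L ν.M₂ (RkOfRecord (F.P K).L ν.r (g k)) k) a 0) (s.Ω k),
        chiSmall (plaqInside (cubeEnl (F.P K) (cubeSide (F.P K).L ν.M₂ (RkOfRecord (F.P K).L ν.r (g k)) k) a 1))
          (epsOfRecord ν g k * (F.P K).eta k ^ 2)
          (ukBox (𝔟 K k) ν.M₁ (cubeEnl (F.P K) (cubeSide (F.P K).L ν.M₂ (RkOfRecord (F.P K).L ν.r (g k)) k) a 4) k V) := by
  rw [chiSeqOfRecordBg, chi218_apply]

/-- On a sequence whose last domain `Ω_k` is the whole lattice, `χ_k(Ω_k)` over a family is `χ_k(T_η)` over the same family (FILE 4's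
`chiSeqOfRecord_of_top`, same proof). [cite: Balaban1988Convergent, (2.17)–(2.18) p.257 (bookkeeping)] -/
theorem chiSeqOfRecordBg_of_top (𝔟 : BgFam F N) (ν : Stage7Numerics) (M : ℕ) (g : ℕ → ℝ) (K k : ℕ) (s : SeqOfRecord F ν M g K k)
    (hs : s.Ω k = Set.univ) : chiSeqOfRecordBg F N 𝔟 ν M g K k s = chiOfRecordBg F N 𝔟 ν g K k := by
  funext V
  rw [chiSeqOfRecordBg, chi218_apply, chiOfRecordBg, B14.Eq216Concrete.chi217]
  rw [hs, cubesIn_univ]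
  exact Finset.prod_coe_sort (cubeIndices (F.P K) (cubeSide (F.P K).L ν.M₂ (RkOfRecord (F.P K).L ν.r (g k)) k))
    (fun a => chiSmall (plaqInside (cubeEnl (F.P K) (cubeSide (F.P K).L ν.M₂ (RkOfRecord (F.P K).L ν.r (g k)) k) a 1))
      (epsOfRecord ν g k * (F.P K).eta k ^ 2)
      (B14.Eq216Concrete.ukBox (𝔟 K k) ν.M₁
        (cubeEnl (F.P K) (cubeSide (F.P K).L ν.M₂ (RkOfRecord (F.P K).L ν.r (g k)) k) a 4) k V))

/-- `0 ≤ χ_k(Ω_k)` over any family. [cite: Balaban1988Convergent, (2.17) p.257 (bookkeeping)] -/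
theorem chiSeqOfRecordBg_nonneg (𝔟 : BgFam F N) (ν : Stage7Numerics) (M : ℕ) (g : ℕ → ℝ) (K k : ℕ) (s : SeqOfRecord F ν M g K k)
    (V : GaugeField (F.P K) k (SU N)) : 0 ≤ chiSeqOfRecordBg F N 𝔟 ν M g K k s V := by
  rw [chiSeqOfRecordBg_apply]
  exact Finset.prod_nonneg fun _ _ => by unfold chiSmall; split_ifs <;> norm_num

/-- `χ_k(Ω_k) ≤ 1` over any family. [cite: Balaban1988Convergent, (2.17) p.257 (bookkeeping)] -/
theorem chiSeqOfRecordBg_le_one (𝔟 : BgFam F N) (ν : Stage7Numerics) (M : ℕ) (g : ℕ → ℝ) (K k : ℕ) (s : SeqOfRecord F ν M g K k)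
    (V : GaugeField (F.P K) k (SU N)) : chiSeqOfRecordBg F N 𝔟 ν M g K k s V ≤ 1 := by
  rw [chiSeqOfRecordBg_apply]
  exact Finset.prod_le_one (fun _ _ => by unfold chiSmall; split_ifs <;> norm_num)
    fun _ _ => by unfold chiSmall; split_ifs <;> norm_num

/-- Each cube factor `χ(…)` is `0` or `1`. [cite: Balaban1988Convergent, (2.17) p.257 (bookkeeping)] -/
theorem chiSmall_eq_zero_or_one {P : Params} {j : ℕ} (pl : Set (Plaq P j)) (δ : ℝ) (U : GaugeField P j (SU N)) :
    chiSmall pl δ U = 0 ∨ chiSmall pl δ U = 1 := by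
  unfold chiSmall; split_ifs <;> simp

/-- `χ_k(Ω_k)` over any family takes only the values `0` and `1`. [cite: Balaban1988Convergent, (2.17) p.257 (bookkeeping)] -/
theorem chiSeqOfRecordBg_eq_zero_or_one (𝔟 : BgFam F N) (ν : Stage7Numerics) (M : ℕ) (g : ℕ → ℝ) (K k : ℕ)
    (s : SeqOfRecord F ν M g K k) (V : GaugeField (F.P K) k (SU N)) :
    chiSeqOfRecordBg F N 𝔟 ν M g K k s V = 0 ∨ chiSeqOfRecordBg F N 𝔟 ν M g K k s V = 1 := by
  rw [chiSeqOfRecordBg_apply]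
  by_cases h : ∀ a ∈ cubesIn (fun a : ↥(cubeIndices (F.P K) (cubeSide (F.P K).L ν.M₂ (RkOfRecord (F.P K).L ν.r (g k)) k)) =>
      cubeEnl (F.P K) (cubeSide (F.P K).L ν.M₂ (RkOfRecord (F.P K).L ν.r (g k)) k) a 0) (s.Ω k),
      chiSmall (plaqInside (cubeEnl (F.P K) (cubeSide (F.P K).L ν.M₂ (RkOfRecord (F.P K).L ν.r (g k)) k) a 1))
        (epsOfRecord ν g k * (F.P K).eta k ^ 2)
        (ukBox (𝔟 K k) ν.M₁ (cubeEnl (F.P K) (cubeSide (F.P K).L ν.M₂ (RkOfRecord (F.P K).L ν.r (g k)) k) a 4) k V) = 1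
  · exact Or.inr (Finset.prod_eq_one h)
  · push Not at h
    obtain ⟨a, ha, hne⟩ := h
    refine Or.inl (Finset.prod_eq_zero ha ?_)
    rcases chiSmall_eq_zero_or_one N
        (plaqInside (cubeEnl (F.P K) (cubeSide (F.P K).L ν.M₂ (RkOfRecord (F.P K).L ν.r (g k)) k) a 1))
        (epsOfRecord ν g k * (F.P K).eta k ^ 2)
        (ukBox (𝔟 K k) ν.M₁ (cubeEnl (F.P K) (cubeSide (F.P K).L ν.M₂ (RkOfRecord (F.P K).L ν.r (g k)) k) a 4) k V) with h0 | h1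
    · exact h0
    · exact absurd h1 hne

end

end Literature.MathematicalPhysics.QuantumFieldTheory.Balaban1983to89.Node00
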